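import Summits.CriticalPhenomena.PercolationContinuityZ3.Theorems.SahiMasterFamilyL3BetaGamma

/-!
# Terminal triples: Lemma L3 — the case (β,γ) forces `C` pure; an N0 coordinate forces a pure event

Part 2 of L3 (paper STRUCTURE-PROOF.md §11 case (β,γ) with §15, verified VERIFICATION-gen3.md): with an N0 coordinate
`e ∈ esupp A ∩ esupp B`, if `(A_e, B_e, C) ∈ Z_3` via `(A_e, C)` (so `A_e` ignores `esupp C`) and
`(A^e, B^e, C) ∈ Z_3` via `(B^e, C)` (so `B^e` ignores `esupp C`), then every coordinate of `esupp C` is mandatory for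
`C` (`pure_of_beta_gamma`): the configuration `esupp A ∩ esupp B ∖ {e}` lies in `B`, every `s ∈ esupp A ∩ esupp C`
is mandatory for `C` (else both `s`-minors are `(A,C)`-realised and Lemma (αα) applies), and then the `t`-minors,
`t ∈ esupp B ∩ esupp C`, force `t` mandatory for `C`.  Then `lemma_L3`: an N0 coordinate `e ∈ esupp A ∩ esupp B`
forces `C` to be PURE — the nine combinations of realising pairs of the two `e`-minors are dispatched to Lemma (αα),
`reduce_to_alpha_alpha`, `pure_of_beta_gamma`, or are directly contradictory.  Everything here is proved; axioms
standard. [this work]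
-/

noncomputable section

open scoped Classical

namespace Summit.CriticalPhenomena.PercolationContinuityZ3.Theorems

open Finset Function
open Literature.Probability.Percolation (DeterminedBy determinedBy_iff)
open Literature.Probability.LatticeModels.Kahn2022 (Affects)

variable {ι : Type*} [Fintype ι]

/-! ### The case (β, γ): `C` is pure -/

/-- **Case (β,γ) of L3.**  With an N0 coordinate `e ∈ esupp A ∩ esupp B`, if `(A_e, B_e, C) ∈ Z_3` via `(A_e, C)`
(so `A_e` ignores `esupp C`) and `(A^e, B^e, C) ∈ Z_3` via `(B^e, C)` (so `B^e` ignores `esupp C`), then every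
coordinate of `esupp C` is mandatory for `C`. [this work] -/
theorem pure_of_beta_gamma {A B C : Set (Set ι)} (hA : IsUpperSet A) (hB : IsUpperSet B) (hC : IsUpperSet C)
    (hAB : (esupp A ∩ esupp B).Nonempty) (hAC : (esupp A ∩ esupp C).Nonempty)
    (hprivA : esupp A ⊆ esupp B ∪ esupp C) (hprivB : esupp B ⊆ esupp A ∪ esupp C)
    (hprivC : esupp C ⊆ esupp A ∪ esupp B) (hcommon : ∀ i, i ∈ esupp A → i ∈ esupp B → i ∉ esupp C)
    (hNSA : ∀ s ∈ esupp A, ({s} : Set ι) ∉ A) (hNSB : ∀ s ∈ esupp B, ({s} : Set ι) ∉ B)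
    (hmin : ∀ i ∈ esupp A ∪ esupp B ∪ esupp C, ∀ b : Bool, SuppZeroFlag 3 ![secAt i b A, secAt i b B, secAt i b C])
    {e : ι} (heA : e ∈ esupp A) (heB : e ∈ esupp B) (hA0 : Set.univ \ {e} ∈ A) (hB0 : Set.univ \ {e} ∈ B)
    (hZA : ZVia (secAt e false A) C (secAt e false B)) (hZB : ZVia (secAt e true B) C (secAt e true A)) :
    ∀ t ∈ esupp C, secAt t false C = ∅ := by
  have heC : e ∉ esupp C := hcommon e heA heB
  have hA0u : IsUpperSet (secAt e false A) := isUpperSet_secAt e false hA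
  have hB0u : IsUpperSet (secAt e false B) := isUpperSet_secAt e false hB
  have hCne : C.Nonempty := by
    obtain ⟨i, hi⟩ := hAC; exact (nonempty_of_esupp_nonempty ⟨i, (mem_inter.1 hi).2⟩).1
  obtain ⟨dA0C, -, -⟩ := zVia_pivotal hA0u hC hB0u hZA
  have memA_iff : ∀ η η' : Set ι, e ∉ η → e ∉ η' →
      η ∩ ↑(esupp (secAt e false A)) = η' ∩ ↑(esupp (secAt e false A)) → (η ∈ A ↔ η' ∈ A) := by
    intro η η' hη hη' heq
    rw [← mem_secAt_false_iff_of_notMem hη, ← mem_secAt_false_iff_of_notMem hη']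
    exact mem_iff_of_inter_esupp_eq hA0u heq
  obtain ⟨hIABmem, mandAC⟩ := beta_gamma_partA hA hB hC hAB hAC hprivA hprivB hprivC hcommon hNSA hNSB hmin heA heB
    hA0 hB0 hZA hZB
  set IAB := esupp A ∩ esupp B with hIAB
  set IAC := esupp A ∩ esupp C with hIAC
  set IBC := esupp B ∩ esupp C with hIBC
  have esC : esupp C = IAC ∪ IBC := by
    ext f; rw [mem_union, hIAC, hIBC, mem_inter, mem_inter]
    constructor
    · intro hf
      rcases mem_union.1 (hprivC hf) with h | h
      · exact Or.inl ⟨h, hf⟩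
      · exact Or.inr ⟨h, hf⟩
    · rintro (⟨-, h⟩ | ⟨-, h⟩) <;> exact h
  have hIBC_A : ∀ t ∈ IBC, t ∉ esupp A := fun t ht h => hcommon t h (mem_inter.1 ht).1 (mem_inter.1 ht).2
  -- Step 4: every `t ∈ IBC` is mandatory for `C`
  obtain ⟨s₀, hs₀⟩ := hAC
  have mandBC : ∀ t ∈ IBC, secAt t false C = ∅ := by
    intro t ht
    have htB := (mem_inter.1 ht).1
    have htC := (mem_inter.1 ht).2
    have hte : t ≠ e := fun hte => heC (hte ▸ htC)
    have htA : t ∉ esupp A := hIBC_A t ht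
    have hts : t ≠ s₀ := fun hts => htA (hts ▸ (mem_inter.1 hs₀).1)
    by_contra hCt
    have hCt' : Set.univ \ {t} ∈ C := by
      by_contra h; exact hCt ((secAt_false_eq_empty_iff hC t).2 h)
    have hBt1 : IsUpperSet (secAt t true B) := isUpperSet_secAt t true hB
    have hBt0 : IsUpperSet (secAt t false B) := isUpperSet_secAt t false hB
    have hCt1 : IsUpperSet (secAt t true C) := isUpperSet_secAt t true hC
    have hCt0 : IsUpperSet (secAt t false C) := isUpperSet_secAt t false hC
    -- `s₀ ∈ esupp` of both `t`-sections of `C` (it is mandatory for `C`)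
    have hs0C1 : s₀ ∈ esupp (secAt t true C) :=
      affects_secAt_true_of_mandatory hC hCne hts (mandAC s₀ hs₀)
    have hs0C0 : s₀ ∈ esupp (secAt t false C) := by
      rw [mem_esupp]
      refine ⟨Set.univ \ {s₀}, ?_, ?_⟩
      · rw [mem_secAt]; simp only [forceAt, cond_false]
        intro h'
        exact (secAt_false_eq_empty_iff hC s₀).1 (mandAC s₀ hs₀) (hC Set.sdiff_subset h')
      · rw [insert_univ_diff, mem_secAt]; simpa only [forceAt, cond_false] using hCt'
    -- the configuration `ζ = Z ∪ esupp C` for a witness `Z` of `e ∈ esupp A`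
    obtain ⟨Z, hZA, heZ'⟩ := mem_esupp.1 heA
    have heZ : e ∉ Z := fun h => hZA (by rwa [Set.insert_eq_of_mem h] at heZ')
    set ζ : Set ι := Z ∪ ↑(esupp C) with hζ
    have heζ : e ∉ ζ := by
      rintro (h | h)
      · exact heZ h
      · exact heC (mem_coe.1 h)
    have hζA : ζ ∉ A := by
      intro h'
      apply hZA
      refine (memA_iff Z ζ heZ heζ ?_).2 h'
      ext f
      simp only [Set.mem_inter_iff, hζ, Set.mem_union, mem_coe]
      constructor
      · rintro ⟨hf, hfA⟩; exact ⟨Or.inl hf, hfA⟩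
      · rintro ⟨hf | hf, hfA⟩
        · exact ⟨hf, hfA⟩
        · exact absurd hf (fun hf => Finset.disjoint_left.1 dA0C hfA hf)
    have hζA' : insert e ζ ∈ A := hA (Set.insert_subset_insert Set.subset_union_left) heZ'
    have hζC : ζ ∈ C := mem_of_esupp_subset hC hCne Set.subset_union_right
    have hζC1 : ζ ∈ secAt t true C := subset_secAt_true hC t hζC
    have hζC0 : ζ ∈ secAt t false C := by
      rw [mem_secAt]; simp only [forceAt, cond_false]
      refine (mem_iff_of_inter_esupp_eq hC (ω' := Set.univ \ {t}) ?_).2 hCt'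
      ext f
      simp only [Set.mem_inter_iff, Set.mem_sdiff, Set.mem_singleton_iff, Set.mem_univ, true_and, hζ, Set.mem_union,
        mem_coe]
      constructor
      · rintro ⟨⟨-, hft⟩, hfC⟩; exact ⟨hft, hfC⟩
      · rintro ⟨hft, hfC⟩; exact ⟨⟨Or.inr hfC, hft⟩, hfC⟩
    -- contraction at `t`: `e` does not affect `B^t`
    have hne1 : ¬ Affects (secAt t true B) e := by
      have hm := hmin t (by simp [htB]) true
      rw [secAt_eq_self_of_not_affects hA (fun h => htA (mem_esupp.2 h)) true] at hm
      rcases (suppZeroFlag_three_iff_zVia _ _ _).1 hm with h | h | h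
      · obtain ⟨-, -, r3⟩ := zVia_pivotal hBt1 hCt1 hA h
        exact fun heBt => r3 e (mem_esupp.2 heBt) ζ hζC1 hζA hζA'
      · exact absurd (zVia_pivotal hA hCt1 hBt1 h).1
          (Finset.not_disjoint_iff.2 ⟨s₀, (mem_inter.1 hs₀).1, hs0C1⟩)
      · -- `B^t` ignores `esupp A ⊇ IAB`: then `{t} ∈ B`
        exfalso
        obtain ⟨dABt, -, -⟩ := zVia_pivotal hA hBt1 hCt1 h
        have h1 : (↑(IAB.erase e) : Set ι) ∈ secAt t true B := subset_secAt_true hB t hIABmem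
        have h0 : (∅ : Set ι) ∈ secAt t true B := by
          refine (mem_iff_of_inter_esupp_eq hBt1 (ω := ∅) (ω' := ↑(IAB.erase e)) ?_).2 h1
          ext f
          simp only [Set.empty_inter, Set.mem_empty_iff_false, Set.mem_inter_iff, mem_coe, mem_erase, false_iff,
            not_and, and_imp]
          intro _ hfAB hfBt
          exact Finset.disjoint_left.1 dABt (mem_inter.1 hfAB).1 hfBt
        rw [mem_secAt] at h0; simp only [forceAt, cond_true, insert_empty_eq] at h0
        exact hNSB t htB h0
    -- deletion at `t`
    have hm := hmin t (by simp [htB]) false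
    rw [secAt_eq_self_of_not_affects hA (fun h => htA (mem_esupp.2 h)) false] at hm
    rcases (suppZeroFlag_three_iff_zVia _ _ _).1 hm with h | h | h
    · obtain ⟨-, -, r3⟩ := zVia_pivotal hBt0 hCt0 hA h
      by_cases heBt : Affects (secAt t false B) e
      · exact r3 e (mem_esupp.2 heBt) ζ hζC0 hζA hζA'
      · exact not_affects_of_secAt hte.symm hne1 heBt (mem_esupp.1 heB)
    · exact absurd (zVia_pivotal hA hCt0 hBt0 h).1 (Finset.not_disjoint_iff.2 ⟨s₀, (mem_inter.1 hs₀).1, hs0C0⟩)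
    · obtain ⟨dABt, -, -⟩ := zVia_pivotal hA hBt0 hCt0 h
      have hne0 : ¬ Affects (secAt t false B) e := fun h' => Finset.disjoint_left.1 dABt heA (mem_esupp.2 h')
      exact not_affects_of_secAt hte.symm hne1 hne0 (mem_esupp.1 heB)
  -- conclusion
  intro f hf
  rw [esC, mem_union] at hf
  rcases hf with hf | hf
  · exact mandAC f hf
  · exact mandBC f hf




/-! ### L3 -/

/-- **L3.**  In a triple of increasing events with pairwise-intersecting essential supports, no private and no common
coordinate, no saturating coordinate, and all minors in `Z_3`, an N0 coordinate `e ∈ esupp A ∩ esupp B` (mandatory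
for neither `A` nor `B`) forces `C` to be pure. [this work] -/
theorem lemma_L3 {A B C : Set (Set ι)} (hA : IsUpperSet A) (hB : IsUpperSet B) (hC : IsUpperSet C)
    (hAB : (esupp A ∩ esupp B).Nonempty) (hAC : (esupp A ∩ esupp C).Nonempty) (hBC : (esupp B ∩ esupp C).Nonempty)
    (hprivA : esupp A ⊆ esupp B ∪ esupp C) (hprivB : esupp B ⊆ esupp A ∪ esupp C)
    (hprivC : esupp C ⊆ esupp A ∪ esupp B) (hcommon : ∀ i, i ∈ esupp A → i ∈ esupp B → i ∉ esupp C)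
    (hNSA : ∀ s ∈ esupp A, ({s} : Set ι) ∉ A) (hNSB : ∀ s ∈ esupp B, ({s} : Set ι) ∉ B)
    (hNSC : ∀ s ∈ esupp C, ({s} : Set ι) ∉ C)
    (hmin : ∀ i ∈ esupp A ∪ esupp B ∪ esupp C, ∀ b : Bool, SuppZeroFlag 3 ![secAt i b A, secAt i b B, secAt i b C])
    {e : ι} (heA : e ∈ esupp A) (heB : e ∈ esupp B) (hA0 : Set.univ \ {e} ∈ A) (hB0 : Set.univ \ {e} ∈ B) :
    ∀ t ∈ esupp C, secAt t false C = ∅ := by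
  have heC : e ∉ esupp C := hcommon e heA heB
  have hCe : ∀ b, secAt e b C = C := fun b => secAt_eq_self_of_not_affects hC (fun h => heC (mem_esupp.2 h)) b
  have hA0u : IsUpperSet (secAt e false A) := isUpperSet_secAt e false hA
  have hA1u : IsUpperSet (secAt e true A) := isUpperSet_secAt e true hA
  have hB0u : IsUpperSet (secAt e false B) := isUpperSet_secAt e false hB
  have hB1u : IsUpperSet (secAt e true B) := isUpperSet_secAt e true hB
  have hD := hmin e (by simp [heA]) false
  have hK := hmin e (by simp [heA]) true
  rw [hCe] at hD hK
  -- symmetric data for the roles `(B, A, C)`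
  have hBA : (esupp B ∩ esupp A).Nonempty := by rwa [inter_comm]
  have hcommon' : ∀ i, i ∈ esupp B → i ∈ esupp A → i ∉ esupp C := fun i hiB hiA => hcommon i hiA hiB
  have hmin' : ∀ i ∈ esupp B ∪ esupp A ∪ esupp C, ∀ b : Bool,
      SuppZeroFlag 3 ![secAt i b B, secAt i b A, secAt i b C] := by
    intro i hi b
    have hi' : i ∈ esupp A ∪ esupp B ∪ esupp C := by
      simp only [mem_union] at hi ⊢; tauto
    exact (suppZeroFlag_three_swap12 (isUpperSet_secAt i b hA) (isUpperSet_secAt i b hB)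
      (isUpperSet_secAt i b hC)).1 (hmin i hi' b)
  have hminAC : ∀ s ∈ esupp A ∩ esupp C, SuppZeroFlag 3 ![secAt s true A, secAt s true B, secAt s true C] :=
    fun s hs => hmin s (by simp [(mem_inter.1 hs).1]) true
  -- two sections of one event cannot both ignore `esupp C`
  have notBothA : ¬ (Disjoint (esupp (secAt e false A)) (esupp C) ∧ Disjoint (esupp (secAt e true A)) (esupp C)) := by
    rintro ⟨d0, d1⟩
    obtain ⟨s, hs⟩ := hAC
    have hsC := (mem_inter.1 hs).2
    rcases mem_esupp_secAt_or (mem_inter.1 hs).1 (fun hse : s = e => heC (hse ▸ hsC)) with h | h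
    · exact Finset.disjoint_left.1 d0 h hsC
    · exact Finset.disjoint_left.1 d1 h hsC
  have notBothB : ¬ (Disjoint (esupp (secAt e false B)) (esupp C) ∧ Disjoint (esupp (secAt e true B)) (esupp C)) := by
    rintro ⟨d0, d1⟩
    obtain ⟨t, ht⟩ := hBC
    have htC := (mem_inter.1 ht).2
    rcases mem_esupp_secAt_or (mem_inter.1 ht).1 (fun hte : t = e => heC (hte ▸ htC)) with h | h
    · exact Finset.disjoint_left.1 d0 h htC
    · exact Finset.disjoint_left.1 d1 h htC
  rcases (suppZeroFlag_three_iff_zVia _ _ _).1 hD with g0 | b0 | a0 <;>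
    rcases (suppZeroFlag_three_iff_zVia _ _ _).1 hK with g1 | b1 | a1
  · -- (γ, γ)
    exact absurd ⟨(zVia_pivotal hB0u hC hA0u g0).1, (zVia_pivotal hB1u hC hA1u g1).1⟩ notBothB
  · -- (γ, β): roles (B, A, C)
    exact pure_of_beta_gamma hB hA hC hBA hBC hprivB hprivA (by rwa [union_comm] at hprivC) hcommon' hNSB hNSA hmin'
      heB heA hB0 hA0 g0 b1
  · -- (γ, α): roles (B, A, C), reduce with v = true
    exact (reduce_to_alpha_alpha hB hA hC hBA hBC hprivB hprivA (by rwa [union_comm] at hprivC) hcommon' hNSB hNSA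
      hNSC hmin' heB heA hB0 hA0 true
      ((zVia_comm hA1u hB1u hC).1 a1) (zVia_pivotal hB0u hC hA0u g0).1).elim
  · -- (β, γ)
    exact pure_of_beta_gamma hA hB hC hAB hAC hprivA hprivB hprivC hcommon hNSA hNSB hmin heA heB hA0 hB0 b0 g1
  · -- (β, β)
    exact absurd ⟨(zVia_pivotal hA0u hC hB0u b0).1, (zVia_pivotal hA1u hC hB1u b1).1⟩ notBothA
  · -- (β, α): reduce with v = true
    exact (reduce_to_alpha_alpha hA hB hC hAB hAC hprivA hprivB hprivC hcommon hNSA hNSB hNSC hmin heA heB hA0 hB0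
      true a1 (zVia_pivotal hA0u hC hB0u b0).1).elim
  · -- (α, γ): roles (B, A, C), reduce with v = false
    exact (reduce_to_alpha_alpha hB hA hC hBA hBC hprivB hprivA (by rwa [union_comm] at hprivC) hcommon' hNSB hNSA
      hNSC hmin' heB heA hB0 hA0 false
      ((zVia_comm hA0u hB0u hC).1 a0) (zVia_pivotal hB1u hC hA1u g1).1).elim
  · -- (α, β): reduce with v = false
    exact (reduce_to_alpha_alpha hA hB hC hAB hAC hprivA hprivB hprivC hcommon hNSA hNSB hNSC hmin heA heB hA0 hB0
      false a0 (zVia_pivotal hA1u hC hB1u b1).1).elim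
  · -- (α, α)
    exact (lemma_alpha_alpha hA hB hC hAC hprivA hprivB hprivC hcommon hNSA hNSC heA heB hA0 hB0 a0 a1 hminAC).elim



end Summit.CriticalPhenomena.PercolationContinuityZ3.Theorems
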